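import Summits.CriticalPhenomena.PercolationContinuityZ3.Theorems.PercNearOneGluingNoHeavyLowerTailSahiOneStepVertexPsi
import Summits.CriticalPhenomena.PercolationContinuityZ3.Theorems.PercNearOneGluingNoHeavyLowerTailSahiOneStepFreeExtension
import Summits.CriticalPhenomena.PercolationContinuityZ3.Theorems.PercNearOneGluingNoHeavyLowerTailSahiOneStepThresholdStep
import Literature.Probability.Percolation.FoldingFibres
import HarnessLib

/-!
# One-step scheme: EXISTENCE OF AN X-GOOD PIVOT among the coordinates a partner depends on ((G2) of the vertex-cover memo)

Support file (prover prim-ineq-prove-3 gen 37; `--supports stmt-CriticalPhenomena-4575`; memo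
`run/shared/lean/prim/prim-ineq-prove-3/PROOF-G37-VERTEX-COVER-PARTNERS.md` §2.2).  No definitions, no named facts, no sorries.

`exists_X_pivot`: for an interior density on `F`, an increasing `F`-determined `B`, and a nonempty `V ⊆ F` such that every coordinate of `F ∖ V`
is free for `B` (its two sections coincide), SOME `e ∈ V` satisfies the hypothesis `hX` of `osN_threshold_goodPivot_step`
(`ℓ¹β⁰ ≤ ℓ⁰β¹`, i.e. `Cov(1_B, x_e | N_F ≤ t) ≥ 0`).  Proof: `Σ_{e∈F} [μ(ball)μ(B∩ball∩{e∈ω}) − μ(ball∩{e∈ω})μ(B∩ball)] ≥ 0`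
(`sum_ball_cov_coord_nonneg`: both sums are layer sums weighted by the level, `sum_real_inter_mem_eq` / `sum_mul_real_inter_layer_eq`, and the
sign is Chebyshev's along the layers, `sum_mul_sum_mul_le_of_mlr`, fed by layer monotonicity `real_inter_layer_mul_le`); each summand equals
`p_e(1−p_e)(ℓ⁰β¹ − ℓ¹β⁰)` (`ball_cov_coord_eq`); free coordinates contribute `≤ 0` (`free_coord_nonpos`, an increasing event prefers the bigger ball).
-/

namespace Summit.CriticalPhenomena.PercolationContinuityZ3.Theorems

namespace SahiOneStep

open Finset
open scoped Classical

variable {ι : Type*}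

/-! ## (G2) Existence of an X-good pivot among the coordinates on which the partner depends -/
section Xexist

variable [Fintype ι]

open MeasureTheory
open Literature.Probability.Percolation (DeterminedBy determinedBy_iff)
open Literature.Probability.LatticeModels (prodBernoulli)
open Literature.Probability.Percolation.DecisionTree (ind ind_of_mem ind_of_not_mem)
open Literature.Probability.Percolation.BHK2006 (weight weight_nonneg)

/-- `Σ_{e ∈ F} μ(S ∩ {e ∈ ω}) = Σ_ω w(ω)·1_S(ω)·#(F ∩ ω)` (linearity). [folklore] -/
theorem sum_real_inter_mem_eq (p : ι → unitInterval) (F : Finset ι) (S : Set (Set ι)) :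
    ∑ e ∈ F, (prodBernoulli p).real (S ∩ {ω : Set ι | e ∈ ω}) =
      ∑ a : Set ι, weight (fun i => (p i : ℝ)) a * ind S a * ((F.filter (· ∈ a)).card : ℝ) := by
  simp_rw [Literature.Probability.Percolation.prodBernoulli_real_eq_sum_weight_ind]
  rw [Finset.sum_comm]
  refine Finset.sum_congr rfl fun a _ => ?_
  have hind : ∀ e, ind (S ∩ {ω : Set ι | e ∈ ω}) a = ind S a * (if e ∈ a then (1 : ℝ) else 0) := by
    intro e
    by_cases hS : a ∈ S <;> by_cases he : e ∈ a <;>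
      simp [ind_of_mem, ind_of_not_mem, hS, he, Set.mem_inter_iff]
  have hcs : (∑ e ∈ F, if e ∈ a then (1 : ℝ) else 0) = ((F.filter (· ∈ a)).card : ℝ) := by
    rw [Finset.sum_boole]
  calc ∑ e ∈ F, weight (fun i => (p i : ℝ)) a * ind (S ∩ {ω : Set ι | e ∈ ω}) a
      = ∑ e ∈ F, (weight (fun i => (p i : ℝ)) a * ind S a) * (if e ∈ a then (1 : ℝ) else 0) :=
        Finset.sum_congr rfl fun e _ => by rw [hind e]; ring
    _ = (weight (fun i => (p i : ℝ)) a * ind S a) * ∑ e ∈ F, (if e ∈ a then (1 : ℝ) else 0) := by rw [Finset.mul_sum]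
    _ = _ := by rw [hcs]

/-- `Σ_{k ≤ |F|} k·μ(S ∩ {N_F = k}) = Σ_ω w(ω)·1_S(ω)·#(F ∩ ω)`. [folklore] -/
theorem sum_mul_real_inter_layer_eq (p : ι → unitInterval) (F : Finset ι) (S : Set (Set ι)) :
    ∑ k ∈ range (F.card + 1), (k : ℝ) * (prodBernoulli p).real (S ∩ {ω : Set ι | (F.filter (· ∈ ω)).card = k}) =
      ∑ a : Set ι, weight (fun i => (p i : ℝ)) a * ind S a * ((F.filter (· ∈ a)).card : ℝ) := by
  simp_rw [Literature.Probability.Percolation.prodBernoulli_real_eq_sum_weight_ind, Finset.mul_sum]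
  rw [Finset.sum_comm]
  refine Finset.sum_congr rfl fun a _ => ?_
  have hind : ∀ k : ℕ, ind (S ∩ {ω : Set ι | (F.filter (· ∈ ω)).card = k}) a = ind S a * (if (F.filter (· ∈ a)).card = k then (1 : ℝ) else 0) := by
    intro k
    by_cases hS : a ∈ S <;> by_cases hk : (F.filter (· ∈ a)).card = k <;>
      simp [ind_of_mem, ind_of_not_mem, hS, hk, Set.mem_inter_iff]
  simp_rw [hind]
  have hcard : (F.filter (· ∈ a)).card < F.card + 1 := Nat.lt_succ_of_le (Finset.card_filter_le _ _)
  rw [show (∑ k ∈ range (F.card + 1), (k : ℝ) * (weight (fun i => (p i : ℝ)) a * (ind S a * if (F.filter (· ∈ a)).card = k then (1 : ℝ) else 0))) =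
      ∑ k ∈ range (F.card + 1), (if (F.filter (· ∈ a)).card = k then weight (fun i => (p i : ℝ)) a * ind S a * (k : ℝ) else 0) from
    Finset.sum_congr rfl fun k _ => by split_ifs <;> ring]
  rw [Finset.sum_ite_eq (range (F.card + 1))]
  rw [if_pos (Finset.mem_range.2 hcard)]

omit [Fintype ι] in
/-- **Chebyshev along the layers.**  For nonnegative sequences with `b_j π_k ≤ b_k π_j` (`j ≤ k`): `(Σ b)(Σ k π_k) ≤ (Σ π)(Σ k b_k)`. [folklore] -/
theorem sum_mul_sum_mul_le_of_mlr (M : ℕ) (b π : ℕ → ℝ) (mlr : ∀ j k, j ≤ k → b j * π k ≤ b k * π j) :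
    (∑ k ∈ range M, b k) * (∑ k ∈ range M, (k : ℝ) * π k) ≤ (∑ k ∈ range M, π k) * (∑ k ∈ range M, (k : ℝ) * b k) := by
  rw [← sub_nonneg]
  have key : (∑ k ∈ range M, π k) * (∑ k ∈ range M, (k : ℝ) * b k) - (∑ k ∈ range M, b k) * (∑ k ∈ range M, (k : ℝ) * π k) =
      ∑ j ∈ range M, ∑ k ∈ range M, (k : ℝ) * (π j * b k - b j * π k) := by
    rw [Finset.sum_mul_sum, Finset.sum_mul_sum, ← Finset.sum_sub_distrib]
    refine Finset.sum_congr rfl fun j _ => ?_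
    rw [← Finset.sum_sub_distrib]
    exact Finset.sum_congr rfl fun k _ => by ring
  have key2 : (∑ j ∈ range M, ∑ k ∈ range M, (k : ℝ) * (π j * b k - b j * π k)) =
      ∑ j ∈ range M, ∑ k ∈ range M, (j : ℝ) * (π k * b j - b k * π j) := Finset.sum_comm
  have hSS : (∑ j ∈ range M, ∑ k ∈ range M, (k : ℝ) * (π j * b k - b j * π k)) +
      (∑ j ∈ range M, ∑ k ∈ range M, (j : ℝ) * (π k * b j - b k * π j)) =
      ∑ j ∈ range M, ∑ k ∈ range M, ((k : ℝ) - j) * (π j * b k - b j * π k) := by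
    rw [← Finset.sum_add_distrib]
    refine Finset.sum_congr rfl fun j _ => ?_
    rw [← Finset.sum_add_distrib]
    exact Finset.sum_congr rfl fun k _ => by ring
  have : 2 * ((∑ k ∈ range M, π k) * (∑ k ∈ range M, (k : ℝ) * b k) - (∑ k ∈ range M, b k) * (∑ k ∈ range M, (k : ℝ) * π k)) =
      ∑ j ∈ range M, ∑ k ∈ range M, ((k : ℝ) - j) * (π j * b k - b j * π k) := by
    rw [← hSS, ← key2, key]; ring
  have hnn : 0 ≤ ∑ j ∈ range M, ∑ k ∈ range M, ((k : ℝ) - j) * (π j * b k - b j * π k) := by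
    refine Finset.sum_nonneg fun j _ => Finset.sum_nonneg fun k _ => ?_
    rcases Nat.lt_or_ge k j with hkj | hjk
    · have h1 : ((k : ℝ) - j) ≤ 0 := sub_nonpos.2 (by exact_mod_cast hkj.le)
      have h2 : π j * b k - b j * π k ≤ 0 := by linarith [mlr k j hkj.le]
      exact mul_nonneg_of_nonpos_of_nonpos h1 h2
    · exact mul_nonneg (sub_nonneg.2 (by exact_mod_cast hjk)) (sub_nonneg.2 (by linarith [mlr j k hjk]))
  linarith

omit [Fintype ι] in
/-- Inner section of the ball `{N_{insert e F} < s+1}` is `{N_F < s}` (`e ∉ F`). [folklore] -/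
theorem section_insert_ball {F : Finset ι} {e : ι} (he : e ∉ F) (s : ℕ) :
    {ω : Set ι | insert e ω ∈ {ω : Set ι | ((insert e F).filter (· ∈ ω)).card < s + 1}} = {ω : Set ι | (F.filter (· ∈ ω)).card < s} := by
  ext ω
  simp only [Set.mem_setOf_eq]
  rw [Finset.filter_congr_decidable (insert e F) (· ∈ insert e ω) _, card_filter_insert_insert he ω]
  constructor <;> intro h <;> omega

omit [Fintype ι] in
/-- Outer section of the ball `{N_{insert e F} < s+1}` is `{N_F < s+1}` (`e ∉ F`). [folklore] -/
theorem section_sdiff_ball {F : Finset ι} {e : ι} (he : e ∉ F) (s : ℕ) :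
    {ω : Set ι | ω \ {e} ∈ {ω : Set ι | ((insert e F).filter (· ∈ ω)).card < s + 1}} = {ω : Set ι | (F.filter (· ∈ ω)).card < s + 1} := by
  ext ω
  simp only [Set.mem_setOf_eq]
  rw [Finset.filter_congr_decidable (insert e F) (· ∈ ω \ {e}) _, card_filter_insert_sdiff he ω]

/-- `μ(X ∩ {e ∈ ω}) = p_e · μ(X¹)`. [folklore] -/
theorem real_inter_mem_eq (p : ι → unitInterval) (e : ι) (X : Set (Set ι)) :
    (prodBernoulli p).real (X ∩ {ω : Set ι | e ∈ ω}) = (p e : ℝ) * (prodBernoulli p).real {ω : Set ι | insert e ω ∈ X} := by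
  rw [real_split p e (X ∩ {ω : Set ι | e ∈ ω})]
  have h1 : {ω : Set ι | insert e ω ∈ X ∩ {ω : Set ι | e ∈ ω}} = {ω : Set ι | insert e ω ∈ X} := by
    ext ω; simp only [Set.mem_setOf_eq, Set.mem_inter_iff, Set.mem_insert_iff, true_or, and_true]
  have h0 : {ω : Set ι | ω \ {e} ∈ X ∩ {ω : Set ι | e ∈ ω}} = ∅ := by
    ext ω; simp only [Set.mem_setOf_eq, Set.mem_inter_iff, Set.mem_sdiff, Set.mem_singleton_iff, not_true_eq_false, and_false,
      Set.mem_empty_iff_false]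
  rw [h1, h0, measureReal_empty, mul_zero, add_zero]

/-- **The per-coordinate identity**: with `ball = {N_{insert e F} < t+1}` (`e ∉ F`),
`μ(ball)·μ(B ∩ ball ∩ {e ∈ ω}) − μ(ball ∩ {e ∈ ω})·μ(B ∩ ball) = p_e(1−p_e)·(ℓ⁰β¹ − ℓ¹β⁰)` in the section quantities of the good-pivot step
on `F`. [this work] -/
theorem ball_cov_coord_eq (p : ι → unitInterval) {F : Finset ι} {e : ι} (he : e ∉ F) (B : Set (Set ι)) (t : ℕ) :
    (prodBernoulli p).real {ω : Set ι | ((insert e F).filter (· ∈ ω)).card < t + 1} *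
        (prodBernoulli p).real (B ∩ {ω : Set ι | ((insert e F).filter (· ∈ ω)).card < t + 1} ∩ {ω : Set ι | e ∈ ω}) -
      (prodBernoulli p).real ({ω : Set ι | ((insert e F).filter (· ∈ ω)).card < t + 1} ∩ {ω : Set ι | e ∈ ω}) *
        (prodBernoulli p).real (B ∩ {ω : Set ι | ((insert e F).filter (· ∈ ω)).card < t + 1}) =
    (p e : ℝ) * (1 - p e) *
      ((prodBernoulli p).real {ω : Set ι | (F.filter (· ∈ ω)).card < t + 1} *
          (prodBernoulli p).real ({ω : Set ι | insert e ω ∈ B} ∩ {ω : Set ι | (F.filter (· ∈ ω)).card < t}) -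
        (prodBernoulli p).real {ω : Set ι | (F.filter (· ∈ ω)).card < t} *
          (prodBernoulli p).real ({ω : Set ι | ω \ {e} ∈ B} ∩ {ω : Set ι | (F.filter (· ∈ ω)).card < t + 1})) := by
  set μ := prodBernoulli p with hμ
  set ball : Set (Set ι) := {ω : Set ι | ((insert e F).filter (· ∈ ω)).card < t + 1} with hball
  have sb1 : {ω : Set ι | insert e ω ∈ ball} = {ω : Set ι | (F.filter (· ∈ ω)).card < t} := section_insert_ball he t
  have sb0 : {ω : Set ι | ω \ {e} ∈ ball} = {ω : Set ι | (F.filter (· ∈ ω)).card < t + 1} := section_sdiff_ball he t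
  have sB1 : {ω : Set ι | insert e ω ∈ B ∩ ball} = {ω : Set ι | insert e ω ∈ B} ∩ {ω : Set ι | (F.filter (· ∈ ω)).card < t} := by
    rw [← sb1]; rfl
  have sB0 : {ω : Set ι | ω \ {e} ∈ B ∩ ball} = {ω : Set ι | ω \ {e} ∈ B} ∩ {ω : Set ι | (F.filter (· ∈ ω)).card < t + 1} := by
    rw [← sb0]; rfl
  rw [real_inter_mem_eq p e (B ∩ ball), real_inter_mem_eq p e ball, real_split p e ball, real_split p e (B ∩ ball), sb1, sb0, sB1, sB0]
  ring

/-- A coordinate that is FREE for `B` contributes non-positively: if both sections of `B` at `e` coincide with an increasing `(F∖e)`-determined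
event, then `ℓ⁰β¹ ≤ ℓ¹β⁰` (an increasing event prefers the bigger ball). [this work] -/
theorem free_coord_nonpos (p : ι → unitInterval) (F' : Finset ι) {U : Set (Set ι)} (hU : IsUpperSet U) (hUF : DeterminedBy U (↑F' : Set ι)) (t : ℕ) :
    (prodBernoulli p).real {ω : Set ι | (F'.filter (· ∈ ω)).card < t + 1} * (prodBernoulli p).real (U ∩ {ω : Set ι | (F'.filter (· ∈ ω)).card < t}) ≤
      (prodBernoulli p).real {ω : Set ι | (F'.filter (· ∈ ω)).card < t} * (prodBernoulli p).real (U ∩ {ω : Set ι | (F'.filter (· ∈ ω)).card < t + 1}) := by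
  set μ := prodBernoulli p with hμ
  set L1 : Set (Set ι) := {ω : Set ι | (F'.filter (· ∈ ω)).card < t} with hL1
  set L0 : Set (Set ι) := {ω : Set ι | (F'.filter (· ∈ ω)).card < t + 1} with hL0
  have h := ball_real_mul_compl_inter_le p F' hU hUF t
  have mUL : ∀ L : Set (Set ι), μ.real (Uᶜ ∩ L) = μ.real L - μ.real (U ∩ L) := by
    intro L
    have h := measureReal_inter_add_sdiff (μ := μ) (s := L) (t := U) MeasurableSet.of_discrete
    have e1 : L ∩ U = U ∩ L := Set.inter_comm _ _
    have e2 : L \ U = Uᶜ ∩ L := by ext ω; simp only [Set.mem_sdiff, Set.mem_inter_iff, Set.mem_compl_iff]; tauto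
    rw [e1, e2] at h; linarith
  have h' : μ.real L1 * μ.real (Uᶜ ∩ L0) ≤ μ.real L0 * μ.real (Uᶜ ∩ L1) := h
  rw [mUL L0, mUL L1] at h'
  nlinarith [h']

end Xexist

section XexistMain

variable [Fintype ι]

open MeasureTheory
open Literature.Probability.Percolation (DeterminedBy determinedBy_iff)
open Literature.Probability.LatticeModels (prodBernoulli)
open SahiE3Sections (determinedBy_section_insert)

omit [Fintype ι] in
/-- `μ(S ∩ {N_F < s} ∩ {N_F = k}) = [k < s]·μ(S ∩ {N_F = k})`. [folklore] -/
theorem real_inter_ballLt_inter_layer (p : ι → unitInterval) (F : Finset ι) (S : Set (Set ι)) (s k : ℕ) :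
    (prodBernoulli p).real (S ∩ {ω : Set ι | (F.filter (· ∈ ω)).card < s} ∩ {ω : Set ι | (F.filter (· ∈ ω)).card = k}) =
      if k < s then (prodBernoulli p).real (S ∩ {ω : Set ι | (F.filter (· ∈ ω)).card = k}) else 0 := by
  by_cases hk : k < s
  · rw [if_pos hk]; congr 1; ext ω
    simp only [Set.mem_inter_iff, Set.mem_setOf_eq]
    constructor
    · rintro ⟨⟨hE, -⟩, hc⟩; exact ⟨hE, hc⟩
    · rintro ⟨hE, hc⟩; exact ⟨⟨hE, hc ▸ hk⟩, hc⟩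
  · rw [if_neg hk]
    have : S ∩ {ω : Set ι | (F.filter (· ∈ ω)).card < s} ∩ {ω : Set ι | (F.filter (· ∈ ω)).card = k} = ∅ := by
      ext ω; simp only [Set.mem_inter_iff, Set.mem_setOf_eq, Set.mem_empty_iff_false, iff_false]
      rintro ⟨⟨-, hs⟩, hc⟩; exact hk (hc ▸ hs)
    rw [this, measureReal_empty]

/-- **Σ_e Cov_ball(1_B, x_e) ≥ 0** (memo §2.2(i)): for `B` increasing and `F`-determined and `ball = {N_F < t+1}`,
`Σ_{e ∈ F} [μ(ball)·μ(B ∩ ball ∩ {e ∈ ω}) − μ(ball ∩ {e ∈ ω})·μ(B ∩ ball)] ≥ 0` — Chebyshev along the layers with layer monotonicity. [this work] -/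
theorem sum_ball_cov_coord_nonneg (p : ι → unitInterval) (F : Finset ι) {B : Set (Set ι)} (hB : IsUpperSet B)
    (hBF : DeterminedBy B (↑F : Set ι)) (t : ℕ) :
    0 ≤ ∑ e ∈ F, ((prodBernoulli p).real {ω : Set ι | (F.filter (· ∈ ω)).card < t + 1} *
        (prodBernoulli p).real (B ∩ {ω : Set ι | (F.filter (· ∈ ω)).card < t + 1} ∩ {ω : Set ι | e ∈ ω}) -
      (prodBernoulli p).real ({ω : Set ι | (F.filter (· ∈ ω)).card < t + 1} ∩ {ω : Set ι | e ∈ ω}) *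
        (prodBernoulli p).real (B ∩ {ω : Set ι | (F.filter (· ∈ ω)).card < t + 1})) := by
  set μ := prodBernoulli p with hμ
  set ball : Set (Set ι) := {ω : Set ι | (F.filter (· ∈ ω)).card < t + 1} with hball
  set b : ℕ → ℝ := fun k => μ.real (B ∩ ball ∩ {ω : Set ι | (F.filter (· ∈ ω)).card = k}) with hb
  set π : ℕ → ℝ := fun k => μ.real (ball ∩ {ω : Set ι | (F.filter (· ∈ ω)).card = k}) with hπ
  have e1 : ∑ e ∈ F, μ.real (B ∩ ball ∩ {ω : Set ι | e ∈ ω}) = ∑ k ∈ range (F.card + 1), (k : ℝ) * b k := by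
    rw [sum_real_inter_mem_eq, ← sum_mul_real_inter_layer_eq]
  have e2 : ∑ e ∈ F, μ.real (ball ∩ {ω : Set ι | e ∈ ω}) = ∑ k ∈ range (F.card + 1), (k : ℝ) * π k := by
    rw [sum_real_inter_mem_eq, ← sum_mul_real_inter_layer_eq]
  have e3 : μ.real ball = ∑ k ∈ range (F.card + 1), π k := real_eq_sum_layers p F ball
  have e4 : μ.real (B ∩ ball) = ∑ k ∈ range (F.card + 1), b k := real_eq_sum_layers p F (B ∩ ball)
  rw [Finset.sum_sub_distrib, ← Finset.mul_sum, ← Finset.sum_mul, e1, e2, e3, e4, sub_nonneg, mul_comm (∑ k ∈ range (F.card + 1), (k : ℝ) * π k)]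
  refine sum_mul_sum_mul_le_of_mlr _ b π fun j k hjk => ?_
  -- layer monotonicity inside the ball
  have hbj : b j = if j < t + 1 then μ.real (B ∩ {ω : Set ι | (F.filter (· ∈ ω)).card = j}) else 0 :=
    real_inter_ballLt_inter_layer p F B (t + 1) j
  have hbk : b k = if k < t + 1 then μ.real (B ∩ {ω : Set ι | (F.filter (· ∈ ω)).card = k}) else 0 :=
    real_inter_ballLt_inter_layer p F B (t + 1) k
  have hπj : π j = if j < t + 1 then μ.real {ω : Set ι | (F.filter (· ∈ ω)).card = j} else 0 := by
    have h := real_inter_ballLt_inter_layer p F Set.univ (t + 1) j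
    simp only [Set.univ_inter] at h; exact h
  have hπk : π k = if k < t + 1 then μ.real {ω : Set ι | (F.filter (· ∈ ω)).card = k} else 0 := by
    have h := real_inter_ballLt_inter_layer p F Set.univ (t + 1) k
    simp only [Set.univ_inter] at h; exact h
  rw [hbj, hbk, hπj, hπk]
  by_cases hk : k < t + 1
  · have hj : j < t + 1 := lt_of_le_of_lt hjk hk
    rw [if_pos hj, if_pos hk, if_pos hj, if_pos hk]
    exact real_inter_layer_mul_le p F hB hBF hjk
  · rw [if_neg hk, if_neg hk, mul_zero, zero_mul]

/-- **(G2) EXISTENCE OF AN X-GOOD PIVOT** (memo §2.2).  `p` interior on `F`; `B` increasing and `F`-determined; `V ⊆ F` nonempty and every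
coordinate of `F ∖ V` FREE for `B` (equal sections).  Then some `e ∈ V` satisfies the hypothesis `hX` of `osN_threshold_goodPivot_step` on the
block `F.erase e`: `ℓ¹β⁰ ≤ ℓ⁰β¹`. [this work] -/
theorem exists_X_pivot (p : ι → unitInterval) (F : Finset ι) (hp : ∀ e ∈ F, 0 < (p e : ℝ) ∧ (p e : ℝ) < 1) {B : Set (Set ι)}
    (hB : IsUpperSet B) (hBF : DeterminedBy B (↑F : Set ι)) (t : ℕ) (V : Finset ι) (hVF : V ⊆ F) (hV : V.Nonempty)
    (hfree : ∀ e ∈ F, e ∉ V → {ω : Set ι | insert e ω ∈ B} = {ω : Set ι | ω \ {e} ∈ B}) :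
    ∃ e ∈ V, (prodBernoulli p).real {ω : Set ι | ((F.erase e).filter (· ∈ ω)).card < t} *
        (prodBernoulli p).real ({ω : Set ι | ω \ {e} ∈ B} ∩ {ω : Set ι | ((F.erase e).filter (· ∈ ω)).card < t + 1}) ≤
      (prodBernoulli p).real {ω : Set ι | ((F.erase e).filter (· ∈ ω)).card < t + 1} *
        (prodBernoulli p).real ({ω : Set ι | insert e ω ∈ B} ∩ {ω : Set ι | ((F.erase e).filter (· ∈ ω)).card < t}) := by
  set μ := prodBernoulli p with hμ
  -- the per-coordinate covariances
  set C : ι → ℝ := fun e => μ.real {ω : Set ι | (F.filter (· ∈ ω)).card < t + 1} *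
        μ.real (B ∩ {ω : Set ι | (F.filter (· ∈ ω)).card < t + 1} ∩ {ω : Set ι | e ∈ ω}) -
      μ.real ({ω : Set ι | (F.filter (· ∈ ω)).card < t + 1} ∩ {ω : Set ι | e ∈ ω}) *
        μ.real (B ∩ {ω : Set ι | (F.filter (· ∈ ω)).card < t + 1}) with hC
  -- each `C e`, `e ∈ F`, in section form
  have hCe : ∀ e ∈ F, C e = (p e : ℝ) * (1 - p e) *
      (μ.real {ω : Set ι | ((F.erase e).filter (· ∈ ω)).card < t + 1} *
          μ.real ({ω : Set ι | insert e ω ∈ B} ∩ {ω : Set ι | ((F.erase e).filter (· ∈ ω)).card < t}) -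
        μ.real {ω : Set ι | ((F.erase e).filter (· ∈ ω)).card < t} *
          μ.real ({ω : Set ι | ω \ {e} ∈ B} ∩ {ω : Set ι | ((F.erase e).filter (· ∈ ω)).card < t + 1})) := by
    intro e he
    have h := ball_cov_coord_eq p (F.notMem_erase e) B t
    rw [Finset.insert_erase he] at h
    exact h
  have hsum : 0 ≤ ∑ e ∈ F, C e := sum_ball_cov_coord_nonneg p F hB hBF t
  -- free coordinates contribute `≤ 0`
  have hfreeC : ∀ e ∈ F, e ∉ V → C e ≤ 0 := by
    intro e he heV
    rw [hCe e he, hfree e he heV]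
    have hU : IsUpperSet {ω : Set ι | ω \ {e} ∈ B} := isUpperSet_section_sdiff hB e
    have hcoe : (↑F : Set ι) \ {e} = ↑(F.erase e) := by rw [Finset.coe_erase]
    have hUF : DeterminedBy {ω : Set ι | ω \ {e} ∈ B} (↑(F.erase e) : Set ι) := hcoe ▸ SahiE3Sections.determinedBy_section_sdiff hBF e
    have hfc := free_coord_nonpos p (F.erase e) hU hUF t
    have hp0 : 0 ≤ (p e : ℝ) := (p e).2.1
    have hp1 : 0 ≤ 1 - (p e : ℝ) := sub_nonneg.2 (p e).2.2
    have : μ.real {ω : Set ι | ((F.erase e).filter (· ∈ ω)).card < t + 1} *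
          μ.real ({ω : Set ι | ω \ {e} ∈ B} ∩ {ω : Set ι | ((F.erase e).filter (· ∈ ω)).card < t}) -
        μ.real {ω : Set ι | ((F.erase e).filter (· ∈ ω)).card < t} *
          μ.real ({ω : Set ι | ω \ {e} ∈ B} ∩ {ω : Set ι | ((F.erase e).filter (· ∈ ω)).card < t + 1}) ≤ 0 := by linarith
    exact mul_nonpos_of_nonneg_of_nonpos (mul_nonneg hp0 hp1) this
  -- hence `Σ_{e ∈ V} C e ≥ 0`, so some `e ∈ V` has `C e ≥ 0`
  have hsplit : ∑ e ∈ F, C e = ∑ e ∈ V, C e + ∑ e ∈ F \ V, C e := by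
    rw [← Finset.sum_union (Finset.disjoint_sdiff), Finset.union_sdiff_of_subset hVF]
  have hrest : ∑ e ∈ F \ V, C e ≤ 0 :=
    Finset.sum_nonpos fun e he => hfreeC e (Finset.mem_sdiff.1 he).1 (Finset.mem_sdiff.1 he).2
  have hV' : 0 ≤ ∑ e ∈ V, C e := by linarith
  obtain ⟨e, heV, hCe0⟩ : ∃ e ∈ V, 0 ≤ C e := by
    by_contra hcon
    push Not at hcon
    have : ∑ e ∈ V, C e < 0 := Finset.sum_neg hcon hV
    linarith
  refine ⟨e, heV, ?_⟩
  have heF : e ∈ F := hVF heV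
  rw [hCe e heF] at hCe0
  have hpq : 0 < (p e : ℝ) * (1 - p e) := mul_pos (hp e heF).1 (by linarith [(hp e heF).2])
  have := nonneg_of_mul_nonneg_right (by rwa [mul_comm] at hCe0) hpq
  linarith

end XexistMain

end SahiOneStep

end Summit.CriticalPhenomena.PercolationContinuityZ3.Theorems
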